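import Literature.IUT.HodgeArakelov.TemperedCurveXuu
import Literature.AnabelianGeometry.EtaleTheta.SettingModelChiThetaCocycleSec
import Literature.AnabelianGeometry.EtaleTheta.SettingModelChiThetaTopology
import HarnessLib

/-!
# [IUTchII] Def. 2.3 (i): the tempered curve `X̲̲_v` INSTANTIATED at the χ-twisted model of the [EtTh] §1 root
# (NV for the B15 «X̲̲-tower» chain at a model carrying Kummer data; proof-only)

Mochizuki, *Inter-universal Teichmüller theory II*, Def. 2.3 (i) (kurims p. 67: "`Π̂_v := Π̂_{X̲̲_v}`") over [EtTh] Def. 2.5 (i)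
(the covering `X̲̲ → X` of type `(1, (ℤ/l)^Θ)`) [cite: MochizukiEtTh2009, Def 2.5 (i) p.39]; [claim: Mochizuki2012, status: disputed].
abc-iut cell, layer L2 → L6 junction, prover abc-iut-L2-d1 (gen 5); PROOF-ONLY over abc-iut-L6-t7's
`DoubleUnderline.temperedCurveXuuOfLevelData` / `groupLevelDataXuu` / `isProfiniteCompletion_temperedCurveXuuOfLevelData_toHat`
(`Literature/IUT/HodgeArakelov/TemperedCurveXuu.lean`, B15 piece 1b), this seat's explicit choice
`doubleUnderlineχSec p l hl : (etaleThetaDataχSec p (etaDdχ p)).DoubleUnderline l` at `ThetaSetting.modelχ p`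
(`SettingModelChiThetaCocycleSec`, `Π^tp_X̲̲ = Huuχ p l`), and abc-iut-w5-d111's `nonempty_groupLevelData_modelχ`
(`SettingModelChiThetaTopology`).

Until now the `X̲̲_v`-side vocabulary of the B15 / PROP22i-IDENT rows was instantiated only over ABSTRACT `DoubleUnderline`
data.  Here it is instantiated at a MODEL with genuine cyclotomic action and a non-trivial theta class:
* `temperedCurveXuu_modelχ_PiTemp` — `Π^tp_{X̲̲_v} = Huuχ p l` (by `rfl`), `temperedCurveXuu_modelχ_K` (`K = ℚ_p`);
* `nonempty_groupLevelData_temperedCurveXuu_modelχ` — the η′ parameter bundle (tempered, slim, Galois-countable) of `X̲̲_v`;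
* `isProfiniteCompletion_temperedCurveXuu_modelχ_toHat` — `Π̂_v` is the profinite completion of `Π^tp_{X̲̲_v}`;
* `exists_temperedCurve_xuu_modelχ` — census form.
SEMI-SYNTHETIC MODEL, consistency evidence only; nothing of [EtTh]/[IUTchII] asserted; no side taken on [IUTchIII] Cor. 3.12.
-/

noncomputable section

namespace Literature.AnabelianGeometry.EtaleTheta.SettingModel

open Literature.AnabelianGeometry.SemiGraphs Literature.AnabelianGeometry.EtaleTheta.ThetaSetting

variable (p : ℕ) [Fact p.Prime] (l : ℕ+) (hl : Odd (l : ℕ))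

/-- **`Π^tp_{X̲̲_v} = Huuχ p l`** for the tempered curve `X̲̲_v` of the χ-model's choice `X̲̲` (by `rfl`).
[cite: MochizukiEtTh2009, Def 2.5 (i) p.39] -/
theorem temperedCurveXuu_modelχ_PiTemp :
    ((doubleUnderlineχSec p l hl).temperedCurveXuuOfLevelData (PNat.ne_zero l)
        (nonempty_groupLevelData_modelχ p).some).PiTemp = ↥(Huuχ p l) := rfl

/-- The base field of `X̲̲_v` at the χ-model is `K = ℚ_p`. [cite: MochizukiEtTh2009, Def 2.5 (i) p.39] -/
theorem temperedCurveXuu_modelχ_K :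
    ((doubleUnderlineχSec p l hl).temperedCurveXuuOfLevelData (PNat.ne_zero l)
        (nonempty_groupLevelData_modelχ p).some).K = ⊥ := rfl

/-- **The η′ parameter bundle of `X̲̲_v` at the χ-model** (tempered, temp-slim, Galois-countable, `G_K ≃ Gal(K̄/K)`), via
abc-iut-L6-t7's `groupLevelDataXuu` from abc-iut-w5-d111's bundle at `modelχ`. [cite: MochizukiEtTh2009, Def 2.5 (i) p.39] -/
theorem nonempty_groupLevelData_temperedCurveXuu_modelχ :
    Nonempty ((doubleUnderlineχSec p l hl).temperedCurveXuuOfLevelData (PNat.ne_zero l)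
        (nonempty_groupLevelData_modelχ p).some).GroupLevelData :=
  ⟨(doubleUnderlineχSec p l hl).groupLevelDataXuu (PNat.ne_zero l) (nonempty_groupLevelData_modelχ p).some⟩

/-- **`Π̂_v = (Π^tp_{X̲̲_v})^∧`** at the χ-model ([IUTchII] Def. 2.3 (i)): `toHat` of `X̲̲_v` is a profinite completion.
[cite: MochizukiEtTh2009, Def 2.5 (i) p.39] -/
theorem isProfiniteCompletion_temperedCurveXuu_modelχ_toHat :
    IsProfiniteCompletion ((doubleUnderlineχSec p l hl).temperedCurveXuuOfLevelData (PNat.ne_zero l)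
        (nonempty_groupLevelData_modelχ p).some).toHat :=
  (doubleUnderlineχSec p l hl).isProfiniteCompletion_temperedCurveXuuOfLevelData_toHat (PNat.ne_zero l) _

include hl in
/-- **Census form**: for every prime `p` and odd `l` there is a tempered curve (the `X̲̲_v` of the χ-model) over `K = ℚ_p` whose
tempered fundamental group IS the χ-model's `Π^tp_X̲̲ = Huuχ p l` — an explicit, non-normal, index-`l²` open subgroup of
`Γ ⋊_χ G_{ℚ_p}` — carrying the η′ parameter bundle and a profinite completion map. [cite: MochizukiEtTh2009, Def 2.5 (i) p.39] -/
theorem exists_temperedCurve_xuu_modelχ :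
    ∃ X : TemperedCurve p, X.K = ⊥ ∧ Nonempty (X.PiTemp ≃ₜ* ↥(Huuχ p l)) ∧ Nonempty X.GroupLevelData ∧
      IsProfiniteCompletion X.toHat :=
  ⟨(doubleUnderlineχSec p l hl).temperedCurveXuuOfLevelData (PNat.ne_zero l) (nonempty_groupLevelData_modelχ p).some,
    rfl, ⟨ContinuousMulEquiv.refl _⟩, nonempty_groupLevelData_temperedCurveXuu_modelχ p l hl,
    isProfiniteCompletion_temperedCurveXuu_modelχ_toHat p l hl⟩

end Literature.AnabelianGeometry.EtaleTheta.SettingModel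

end
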